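import Literature.Topology.FourManifolds.TrisectionsJointChart
import Mathlib.Geometry.Manifold.PartitionOfUnity
import HarnessLib

/-!
# Global normal coordinates along the central surface of a Gay–Kirby trisection

Topic `Literature/Topology/FourManifolds`; infrastructure for the fact seat
`provefact-Literature.Topology.FourManifolds.exists-14560f9fc8` (named fact (c′)
`Literature.Topology.FourManifolds.exists_stabilized_gkTrisection`), continuing
`TrisectionsJointChart.lean`.  Everything in this file is **proved**; no definitions, no named
facts.

**Theorem (`IsGKTrisection.exists_normalCoordinates`).**  *Let `S` be a trisection with corners
of a closed smooth `4`-manifold `X` (`Literature.Topology.FourManifolds.IsGKTrisection`), `S i`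
a sector and `S j` a second sector.  There are smooth functions `u, v : X → ℝ` and an open
neighbourhood `U` of the central surface `F = ⋂ l, S l` such that*
`S i ∩ U = {u ≥ 0, v ≥ 0}`, `S j ∩ U = {u ≤ 0, u ≤ v}`, `S l ∩ U = {v ≤ 0, v ≤ u}`,
`F = {u = v = 0}`,
*and at every point of `F` the functions `u, v` are the first two coordinates of a chart of the
maximal `C^∞` atlas.*  This globalises the joint chart of `TrisectionsJointChart.lean` along
`F` — Gay–Kirby's "`Xᵢ` is locally `F × (sector)`" with one pair of normal coordinates for the
whole central surface — and is the input for the product structure (a retraction onto `F`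
along two commuting flows) and for the corner-slice atlases of `TrisectionsSectorAtlas.lean`.

**Proof.**  Cover the compact `F` by joint charts `Θ_α` (`IsGKTrisection.exists_jointChart`,
neighbour `S j` prescribed across the first face), take a smooth partition of unity `(f_α)` on
`F` subordinate to their domains (Mathlib's `SmoothPartitionOfUnity.exists_isSubordinate`) and
put `u = ∑ f_α (Θ_α)₀`, `v = ∑ f_α (Θ_α)₁`.  On `U = {∑ f_α > 0}` the set identities hold
because the three model sectors `{q ≥ 0}`, `{q₀ ≤ 0, q₀ ≤ q₁}`, `{q₁ ≤ 0, q₁ ≤ q₀}` are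
*convex cones* (so nonnegative combinations of the chart coordinates stay in them) meeting
pairwise in rays (so a nonnegative combination lying in two of them forces every active term
onto the common ray, `eq_zero_of_sum_mul_nonneg`).  At `x ∈ F`, in the joint chart `Θ_β`,
the transitions `Θ_α ∘ Θ_β⁻¹` preserve the three sectors, hence act on the normal plane as
positive homotheties to first order (`firstOrder_of_jointTransition`: a linear map of the plane
preserving the three rays `ℝ₊e₀`, `ℝ₊e₁`, `ℝ₊(-e₀-e₁)` is a positive multiple of the
identity), so `du = Λ d(Θ_β)₀`, `dv = Λ d(Θ_β)₁` at `x` with `Λ = ∑ f_α(x) a_α > 0`, and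
`(u, v, (Θ_β)₂, (Θ_β)₃)` is a chart at `x` by the inverse function theorem (its local inverse
is `C^∞`, so it is in the maximal atlas: `contDiffGroupoid_mem_of_contDiffOn_symm`,
`trans_mem_maximalAtlas`).

## References

* D. Gay, R. Kirby, *Trisecting 4-manifolds*, Geom. Topol. 20 (2016) 3097–3132
  (arXiv:1205.1565): Def. 1 and Fig. 1 (the sectors near the central surface), Def. 8
  (stabilisation is performed in a product neighbourhood of arcs ending on `F`). [GayKirby2016]
* M. W. Hirsch, *Differential Topology* (1976), §1.4 and §2.2 (partitions of unity, gluing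
  local data by convexity). [Hirsch1976]
-/

open scoped Manifold ContDiff Topology
open Set Function Filter

noncomputable section

namespace Literature.Topology.FourManifolds

universe u

/-! ## Global normal coordinates along the central surface -/

/-! ### First-order rigidity of the transition between two joint charts -/

section JointTransition

/-- Along the line `t ↦ p + t v` the points stay in the domain of an `eventually` hypothesis
(copy of the private helper of `TrisectionsCentralSurfaceTangent.lean`). [folklore] -/
private theorem eventually_line {p : EuclideanSpace ℝ (Fin 4)}
    {P : EuclideanSpace ℝ (Fin 4) → Prop} (hP : ∀ᶠ z in 𝓝 p, P z)
    (v : EuclideanSpace ℝ (Fin 4)) : ∀ᶠ t in 𝓝[>] (0:ℝ), P (p + t • v) := by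
  have hc : Tendsto (fun t : ℝ => p + t • v) (𝓝 0) (𝓝 p) := by
    have : Continuous fun t : ℝ => p + t • v := by fun_prop
    simpa using this.tendsto 0
  exact (hc.eventually hP).filter_mono nhdsWithin_le_nhds

variable {T : EuclideanSpace ℝ (Fin 4) → EuclideanSpace ℝ (Fin 4)}
  {L : EuclideanSpace ℝ (Fin 4) →L[ℝ] EuclideanSpace ℝ (Fin 4)}

/-- **The transition between two joint charts is conformal on the normal plane, to first
order.**  If a map `T` of `ℝ⁴`, differentiable at `0` with injective derivative `L`, preserves
near `0` the three linear sectors `Q = {q₀, q₁ ≥ 0}`, `W₁ = {q₀ ≤ 0, q₀ ≤ q₁}`,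
`W₂ = {q₁ ≤ 0, q₁ ≤ q₀}` of the normal plane (times `ℝ²`), then `L` preserves the stratum plane
`{q₀ = q₁ = 0}` and acts on the two normal coordinates as **multiplication by one positive
scalar**: `(L w)₀ = a w₀`, `(L w)₁ = a w₁` (`L` must preserve the three pairwise intersections
— the rays through `e₀`, `e₁` and `-e₀-e₁` — and a linear map of the plane fixing three pairwise
independent rays is a positive homothety). [folklore] -/
theorem firstOrder_of_jointTransition (hT : HasFDerivAt T L 0) (hLinj : Injective L)
    (hQ : ∀ᶠ z in 𝓝 (0 : EuclideanSpace ℝ (Fin 4)),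
      (0 ≤ z 0 ∧ 0 ≤ z 1) → (0 ≤ T z 0 ∧ 0 ≤ T z 1))
    (hJ : ∀ᶠ z in 𝓝 (0 : EuclideanSpace ℝ (Fin 4)),
      (z 0 ≤ 0 ∧ z 0 ≤ z 1) → (T z 0 ≤ 0 ∧ T z 0 ≤ T z 1))
    (hK : ∀ᶠ z in 𝓝 (0 : EuclideanSpace ℝ (Fin 4)),
      (z 1 ≤ 0 ∧ z 1 ≤ z 0) → (T z 1 ≤ 0 ∧ T z 1 ≤ T z 0)) :
    (∀ w : EuclideanSpace ℝ (Fin 4), w 0 = 0 → w 1 = 0 → L w 0 = 0 ∧ L w 1 = 0) ∧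
      ∃ a : ℝ, 0 < a ∧ ∀ w : EuclideanSpace ℝ (Fin 4), L w 0 = a * w 0 ∧ L w 1 = a * w 1 := by
  -- stratum points go to stratum points
  have hstr : ∀ᶠ z in 𝓝 (0 : EuclideanSpace ℝ (Fin 4)),
      (z 0 = 0 ∧ z 1 = 0) → (T z 0 = 0 ∧ T z 1 = 0) := by
    filter_upwards [hQ, hJ, hK] with z hq hj hk hz
    obtain ⟨hq0, hq1⟩ := hq ⟨le_of_eq hz.1.symm, le_of_eq hz.2.symm⟩
    obtain ⟨hj0, -⟩ := hj ⟨le_of_eq hz.1, by rw [hz.1, hz.2]⟩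
    obtain ⟨hk1, -⟩ := hk ⟨le_of_eq hz.2, by rw [hz.1, hz.2]⟩
    exact ⟨le_antisymm hj0 hq0, le_antisymm hk1 hq1⟩
  have hT0 : T 0 0 = 0 ∧ T 0 1 = 0 := hstr.self_of_nhds ⟨rfl, rfl⟩
  have hLstr : ∀ w : EuclideanSpace ℝ (Fin 4), w 0 = 0 → w 1 = 0 → L w 0 = 0 ∧ L w 1 = 0 :=
    fun w hw0 hw1 => apply_stratum_of_hasFDerivAt hT ⟨rfl, rfl⟩ hstr hw0 hw1
  set e0 : EuclideanSpace ℝ (Fin 4) := EuclideanSpace.single 0 1 with he0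
  set e1 : EuclideanSpace ℝ (Fin 4) := EuclideanSpace.single 1 1 with he1
  -- the ray through `e₀` (`= Q ∩ W₂`) is preserved
  have h0 : 0 ≤ L e0 0 ∧ L e0 1 = 0 := by
    have hKc : IsClosed {q : EuclideanSpace ℝ (Fin 4) | 0 ≤ q 0 ∧ q 1 = 0} :=
      (isClosed_le continuous_const (EuclideanSpace.proj (0 : Fin 4)).continuous).inter
        (isClosed_eq (EuclideanSpace.proj (1 : Fin 4)).continuous continuous_const)
    refine mem_of_tendsto_smul_of_cone (K := {q | 0 ≤ q 0 ∧ q 1 = 0}) hKc ?_ ?_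
      (tendsto_smul_sub_of_hasFDerivAt hT e0)
    · rintro t ht k ⟨hk0, hk1⟩
      exact ⟨by simpa using mul_nonneg ht.le hk0, by simp [hk1]⟩
    · filter_upwards [eventually_line (p := 0) hQ e0, eventually_line (p := 0) hK e0,
        self_mem_nhdsWithin] with t hq hk htpos
      have ht : 0 < t := htpos
      have hz0 : ((0 : EuclideanSpace ℝ (Fin 4)) + t • e0) 0 = t := by simp [he0]
      have hz1 : ((0 : EuclideanSpace ℝ (Fin 4)) + t • e0) 1 = 0 := by simp [he0]
      obtain ⟨hq0, -⟩ := hq ⟨by rw [hz0]; exact ht.le, by rw [hz1]⟩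
      obtain ⟨hk1, -⟩ := hk ⟨by rw [hz1], by rw [hz0, hz1]; exact ht.le⟩
      refine ⟨?_, ?_⟩
      · simp only [PiLp.sub_apply, hT0.1, sub_zero]; exact hq0
      · simp only [PiLp.sub_apply, hT0.2, sub_zero]
        have hq1 : 0 ≤ T (0 + t • e0) 1 := (hq ⟨by rw [hz0]; exact ht.le, by rw [hz1]⟩).2
        exact le_antisymm hk1 hq1
  -- the ray through `e₁` (`= Q ∩ W₁`) is preserved
  have h1 : L e1 0 = 0 ∧ 0 ≤ L e1 1 := by
    have hKc : IsClosed {q : EuclideanSpace ℝ (Fin 4) | q 0 = 0 ∧ 0 ≤ q 1} :=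
      (isClosed_eq (EuclideanSpace.proj (0 : Fin 4)).continuous continuous_const).inter
        (isClosed_le continuous_const (EuclideanSpace.proj (1 : Fin 4)).continuous)
    refine mem_of_tendsto_smul_of_cone (K := {q | q 0 = 0 ∧ 0 ≤ q 1}) hKc ?_ ?_
      (tendsto_smul_sub_of_hasFDerivAt hT e1)
    · rintro t ht k ⟨hk0, hk1⟩
      exact ⟨by simp [hk0], by simpa using mul_nonneg ht.le hk1⟩
    · filter_upwards [eventually_line (p := 0) hQ e1, eventually_line (p := 0) hJ e1,
        self_mem_nhdsWithin] with t hq hj htpos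
      have ht : 0 < t := htpos
      have hz0 : ((0 : EuclideanSpace ℝ (Fin 4)) + t • e1) 0 = 0 := by simp [he1]
      have hz1 : ((0 : EuclideanSpace ℝ (Fin 4)) + t • e1) 1 = t := by simp [he1]
      obtain ⟨hq0, hq1⟩ := hq ⟨by rw [hz0], by rw [hz1]; exact ht.le⟩
      obtain ⟨hj0, -⟩ := hj ⟨by rw [hz0], by rw [hz0, hz1]; exact ht.le⟩
      refine ⟨?_, ?_⟩
      · simp only [PiLp.sub_apply, hT0.1, sub_zero]; exact le_antisymm hj0 hq0
      · simp only [PiLp.sub_apply, hT0.2, sub_zero]; exact hq1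
  -- the diagonal ray (`= W₁ ∩ W₂`) is preserved
  have h2 : L (-e0 - e1) 0 = L (-e0 - e1) 1 ∧ L (-e0 - e1) 0 ≤ 0 := by
    have hKc : IsClosed {q : EuclideanSpace ℝ (Fin 4) | q 0 = q 1 ∧ q 0 ≤ 0} :=
      (isClosed_eq (EuclideanSpace.proj (0 : Fin 4)).continuous
        (EuclideanSpace.proj (1 : Fin 4)).continuous).inter
        (isClosed_le (EuclideanSpace.proj (0 : Fin 4)).continuous continuous_const)
    refine mem_of_tendsto_smul_of_cone (K := {q | q 0 = q 1 ∧ q 0 ≤ 0}) hKc ?_ ?_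
      (tendsto_smul_sub_of_hasFDerivAt hT (-e0 - e1))
    · rintro t ht k ⟨hk0, hk1⟩
      exact ⟨by simp [hk0], by simpa using mul_nonpos_of_nonneg_of_nonpos ht.le hk1⟩
    · filter_upwards [eventually_line (p := 0) hJ (-e0 - e1),
        eventually_line (p := 0) hK (-e0 - e1), self_mem_nhdsWithin] with t hj hk htpos
      have ht : 0 < t := htpos
      have hz0 : ((0 : EuclideanSpace ℝ (Fin 4)) + t • (-e0 - e1)) 0 = -t := by simp [he0, he1]
      have hz1 : ((0 : EuclideanSpace ℝ (Fin 4)) + t • (-e0 - e1)) 1 = -t := by simp [he0, he1]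
      obtain ⟨hj0, hj1⟩ := hj ⟨by rw [hz0]; linarith, by rw [hz0, hz1]⟩
      obtain ⟨-, hk1⟩ := hk ⟨by rw [hz1]; linarith, by rw [hz0, hz1]⟩
      refine ⟨?_, ?_⟩
      · simp only [PiLp.sub_apply, hT0.1, hT0.2, sub_zero]
        exact le_antisymm hj1 hk1
      · simp only [PiLp.sub_apply, hT0.1, sub_zero]; exact hj0
  -- comparing: `a = b = c`
  set a := L e0 0 with ha
  set b := L e1 1 with hb
  have hcomp0 : L (-e0 - e1) 0 = -a := by
    simp only [map_sub, map_neg, PiLp.sub_apply, PiLp.neg_apply, h1.1]; ring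
  have hcomp1 : L (-e0 - e1) 1 = -b := by
    simp only [map_sub, map_neg, PiLp.sub_apply, PiLp.neg_apply, h0.2]; ring
  have hab : a = b := by
    have := h2.1; rw [hcomp0, hcomp1] at this; linarith
  -- the formula on all of `ℝ⁴`
  have hformula : ∀ w : EuclideanSpace ℝ (Fin 4), L w 0 = a * w 0 ∧ L w 1 = a * w 1 := by
    intro w
    set s : EuclideanSpace ℝ (Fin 4) := w - (w 0) • e0 - (w 1) • e1 with hs
    have hs0 : s 0 = 0 := by simp [hs, he0, he1]
    have hs1 : s 1 = 0 := by simp [hs, he0, he1]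
    obtain ⟨hLs0, hLs1⟩ := hLstr s hs0 hs1
    have hw : w = (w 0) • e0 + (w 1) • e1 + s := by rw [hs]; abel
    constructor
    · conv_lhs => rw [hw]
      simp only [map_add, map_smul, PiLp.add_apply, PiLp.smul_apply, smul_eq_mul, hLs0, h1.1,
        ← ha]
      ring
    · conv_lhs => rw [hw]
      simp only [map_add, map_smul, PiLp.add_apply, PiLp.smul_apply, smul_eq_mul, hLs1, h0.2,
        ← hb, ← hab]
      ring
  -- `a > 0` by injectivity
  have hapos : 0 < a := by
    rcases h0.1.lt_or_eq with h | h
    · exact h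
    · exfalso
      have hstr_e0 := stratum_of_apply_stratum hLinj hLstr (w := e0)
        (by rw [(hformula e0).1, ← h]; ring) (by rw [(hformula e0).2, ← h]; ring)
      simp [he0] at hstr_e0
  exact ⟨hLstr, a, hapos, hformula⟩

end JointTransition

/-! ### Nonnegative combinations in the three sectors -/

section Cones

/-- In a finite nonnegative combination `∑ c_α t_α ≥ 0` of nonpositive numbers with positive
weights every term vanishes. [folklore] -/
theorem eq_zero_of_sum_mul_nonneg {ι : Type*} {A : Finset ι} {c t : ι → ℝ}
    (hc : ∀ α ∈ A, 0 < c α) (ht : ∀ α ∈ A, t α ≤ 0) (hsum : 0 ≤ ∑ α ∈ A, c α * t α) :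
    ∀ α ∈ A, t α = 0 := by
  have hle : ∀ α ∈ A, c α * t α ≤ 0 := fun α hα =>
    mul_nonpos_of_nonneg_of_nonpos (hc α hα).le (ht α hα)
  have hsum0 : ∑ α ∈ A, c α * t α = 0 := le_antisymm (Finset.sum_nonpos hle) hsum
  have hneg : ∀ α ∈ A, 0 ≤ -(c α * t α) := fun α hα => neg_nonneg.mpr (hle α hα)
  have hsum0' : ∑ α ∈ A, -(c α * t α) = 0 := by rw [Finset.sum_neg_distrib, hsum0, neg_zero]
  intro α hα
  have h := (Finset.sum_eq_zero_iff_of_nonneg hneg).1 hsum0' α hα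
  have : c α * t α = 0 := by linarith
  rcases mul_eq_zero.mp this with h' | h'
  · exact absurd h' (hc α hα).ne'
  · exact h'

/-- Dually, in `∑ c_α t_α ≤ 0` with `t_α ≥ 0` and positive weights every term vanishes.
[folklore] -/
theorem eq_zero_of_sum_mul_nonpos {ι : Type*} {A : Finset ι} {c t : ι → ℝ}
    (hc : ∀ α ∈ A, 0 < c α) (ht : ∀ α ∈ A, 0 ≤ t α) (hsum : ∑ α ∈ A, c α * t α ≤ 0) :
    ∀ α ∈ A, t α = 0 := by
  have h := eq_zero_of_sum_mul_nonneg (t := fun α => -t α) hc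
    (fun α hα => neg_nonpos.mpr (ht α hα)) (by
      have : ∑ α ∈ A, c α * -t α = -∑ α ∈ A, c α * t α := by
        rw [← Finset.sum_neg_distrib]; exact Finset.sum_congr rfl fun α _ => by ring
      rw [this]; exact neg_nonneg.mpr hsum)
  intro α hα
  have := h α hα
  simpa using this

end Cones

/-! ### Global normal coordinates -/

section NormalCoordinates

variable {X : Type u} [TopologicalSpace X] [T2Space X] [CompactSpace X]
  [ChartedSpace (EuclideanSpace ℝ (Fin 4)) X] [IsManifold (𝓡 4) ∞ X]
  {g : ℕ} {k : Fin 3 → ℕ} {S : Fin 3 → Set X}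

/-- **Global normal coordinates along the central surface of a Gay–Kirby trisection.**  For a
trisection with corners `S` of a closed smooth `4`-manifold `X`, a sector `S i` and a second
sector `S j`, there are two smooth functions `u, v : X → ℝ` and an open neighbourhood `U` of
the central surface `F` in which all three sectors are *globally* the three linear sectors of
the `(u, v)`-plane:
`S i ∩ U = {u ≥ 0, v ≥ 0}`, `S j ∩ U = {u ≤ 0, u ≤ v}`, `S l ∩ U = {v ≤ 0, v ≤ u}`,
`F = {u = v = 0}`,
and at every point of `F` the pair `(u, v)` is completed to a chart of the maximal atlas by two
further coordinates.  (Glue the joint charts of `IsGKTrisection.exists_jointChart` by a smooth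
partition of unity: the three linear sectors are convex cones, so nonnegative combinations of
the chart coordinates cut out the same sets; and the transitions between joint charts act on
the normal plane as positive homotheties to first order, `firstOrder_of_jointTransition`, so
the glued differentials `du`, `dv` stay independent along `F`.)  This is the "`F × (sector)`"
normal form of Gay–Kirby's Def. 1 for the corner-chart predicate.
[cite: GayKirby2016, Def. 1 and Fig. 1] -/
theorem IsGKTrisection.exists_normalCoordinates (h : IsGKTrisection X g k S) {i j : Fin 3}
    (hji : j ≠ i) :
    ∃ (u v : X → ℝ) (U : Set X) (l : Fin 3), l ≠ i ∧ l ≠ j ∧ IsOpen U ∧ (⋂ m, S m) ⊆ U ∧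
      ContMDiff (𝓡 4) 𝓘(ℝ, ℝ) ∞ u ∧ ContMDiff (𝓡 4) 𝓘(ℝ, ℝ) ∞ v ∧
      (∀ y ∈ U, y ∈ S i ↔ 0 ≤ u y ∧ 0 ≤ v y) ∧
      (∀ y ∈ U, y ∈ S j ↔ u y ≤ 0 ∧ u y ≤ v y) ∧
      (∀ y ∈ U, y ∈ S l ↔ v y ≤ 0 ∧ v y ≤ u y) ∧
      (∀ y ∈ U, y ∈ (⋂ m, S m) ↔ u y = 0 ∧ v y = 0) ∧
      (∀ x ∈ ⋂ m, S m, ∃ Ξ : OpenPartialHomeomorph X (EuclideanSpace ℝ (Fin 4)),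
        Ξ ∈ IsManifold.maximalAtlas (𝓡 4) ∞ X ∧ x ∈ Ξ.source ∧
        ∀ y ∈ Ξ.source, Ξ y 0 = u y ∧ Ξ y 1 = v y) := by
  -- the third index
  obtain ⟨l, hli, hlj⟩ : ∃ l : Fin 3, l ≠ i ∧ l ≠ j := by
    have : ∀ i j : Fin 3, ∃ l : Fin 3, l ≠ i ∧ l ≠ j := by decide
    exact this i j
  have third : ∀ m : Fin 3, m ≠ i → m ≠ j → m = l := by
    intro m hmi hmj
    have hcases : ∀ i j l m : Fin 3, j = i ∨ l = i ∨ l = j ∨ m = i ∨ m = j ∨ m = l := by decide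
    rcases hcases i j l m with h' | h' | h' | h' | h' | h'
    exacts [absurd h' hji, absurd h' hli, absurd h' hlj, absurd h' hmi, absurd h' hmj, h']
  set F : Set X := ⋂ m, S m with hFdef
  have hFclosed : IsClosed F := (h.isCompact_iInter).isClosed
  -- joint charts at the points of `F`
  choose Θ lx hΘ using fun x : F => h.exists_jointChart hji x.2
  have hlx : ∀ x : F, lx x = l := fun x => third _ (hΘ x).2.2.2.1 (hΘ x).2.2.2.2.1
  have hΘmem : ∀ x : F, Θ x ∈ IsManifold.maximalAtlas (𝓡 4) ∞ X := fun x => (hΘ x).1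
  have hΘsrc : ∀ x : F, (x : X) ∈ (Θ x).source := fun x => (hΘ x).2.1
  have hSi : ∀ (x : F), ∀ y ∈ (Θ x).source, y ∈ S i ↔ 0 ≤ Θ x y 0 ∧ 0 ≤ Θ x y 1 :=
    fun x => (hΘ x).2.2.2.2.2.1
  have hFx : ∀ (x : F), ∀ y ∈ (Θ x).source, y ∈ F ↔ Θ x y 0 = 0 ∧ Θ x y 1 = 0 :=
    fun x => (hΘ x).2.2.2.2.2.2.1
  have hSj : ∀ (x : F), ∀ y ∈ (Θ x).source, y ∈ S j ↔ Θ x y 0 ≤ 0 ∧ Θ x y 0 ≤ Θ x y 1 :=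
    fun x => (hΘ x).2.2.2.2.2.2.2.1
  have hSl : ∀ (x : F), ∀ y ∈ (Θ x).source, y ∈ S l ↔ Θ x y 1 ≤ 0 ∧ Θ x y 1 ≤ Θ x y 0 := by
    intro x; rw [← hlx x]; exact (hΘ x).2.2.2.2.2.2.2.2
  -- a smooth partition of unity on `F` subordinate to the chart domains
  obtain ⟨f, hf⟩ := SmoothPartitionOfUnity.exists_isSubordinate (ι := F) (I := 𝓡 4) (M := X)
    hFclosed (fun x => (Θ x).source) (fun x => (Θ x).open_source)
    (fun y hy => mem_iUnion.2 ⟨⟨y, hy⟩, hΘsrc ⟨y, hy⟩⟩)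
  -- the glued coordinates
  set u : X → ℝ := fun y => ∑ᶠ α, f α y * Θ α y 0 with hu
  set v : X → ℝ := fun y => ∑ᶠ α, f α y * Θ α y 1 with hv
  have hcoord : ∀ (α : F) (c : Fin 4), ∀ y ∈ tsupport (f α),
      ContMDiffAt (𝓡 4) 𝓘(ℝ, ℝ) ∞ (fun y => Θ α y c) y := by
    intro α c y hy
    have hysrc : y ∈ (Θ α).source := hf α hy
    have h1 : ContMDiffAt (𝓡 4) (𝓡 4) ∞ (Θ α) y :=
      (contMDiffOn_of_mem_maximalAtlas (hΘmem α)).contMDiffAt ((Θ α).open_source.mem_nhds hysrc)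
    have h2 : ContMDiff (𝓡 4) 𝓘(ℝ, ℝ) ∞
        (fun q : EuclideanSpace ℝ (Fin 4) => q c) := by
      rw [contMDiff_iff_contDiff]
      exact contDiff_piLp_apply (p := 2) (i := c)
    exact h2.contMDiffAt.comp y h1
  have husmooth : ContMDiff (𝓡 4) 𝓘(ℝ, ℝ) ∞ u :=
    f.contMDiff_finsum_smul (n := ⊤) (g := fun α y => Θ α y 0) fun α y hy => hcoord α 0 y hy
  have hvsmooth : ContMDiff (𝓡 4) 𝓘(ℝ, ℝ) ∞ v :=
    f.contMDiff_finsum_smul (n := ⊤) (g := fun α y => Θ α y 1) fun α y hy => hcoord α 1 y hy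
  -- the neighbourhood where some weight is positive
  set U : Set X := {y | 0 < ∑ᶠ α, f α y} with hU
  have hUopen : IsOpen U := isOpen_lt continuous_const (f.contMDiff_sum).continuous
  have hFU : F ⊆ U := fun y hy => by
    show 0 < ∑ᶠ α, f α y
    rw [f.sum_eq_one hy]; exact one_pos
  -- finite active sets
  have hfin : ∀ y, (Function.support fun α => f α y).Finite := fun y =>
    f.locallyFinite.point_finite y
  have key : ∀ y ∈ U, ∃ A : Finset F, A.Nonempty ∧ (∀ α ∈ A, 0 < f α y) ∧
      (∀ α ∈ A, y ∈ (Θ α).source) ∧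
      (∀ t : F → ℝ, (∑ᶠ α, f α y * t α) = ∑ α ∈ A, f α y * t α) := by
    intro y hy
    set A := (hfin y).toFinset with hA
    have hmemA : ∀ α, α ∈ A ↔ f α y ≠ 0 := fun α => by
      rw [hA, Set.Finite.mem_toFinset, Function.mem_support]
    have hsum : ∀ t : F → ℝ, (∑ᶠ α, f α y * t α) = ∑ α ∈ A, f α y * t α := by
      intro t
      apply finsum_eq_sum_of_support_subset
      intro α hα
      rw [Function.mem_support] at hα
      rw [Finset.mem_coe, hmemA]
      exact fun h0 => hα (by rw [h0, zero_mul])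
    refine ⟨A, ?_, fun α hα => lt_of_le_of_ne (f.nonneg α y) (Ne.symm ((hmemA α).1 hα)),
      fun α hα => hf α (subset_tsupport _ (Function.mem_support.2 ((hmemA α).1 hα))), hsum⟩
    by_contra hne
    rw [Finset.not_nonempty_iff_eq_empty] at hne
    have : (∑ᶠ α, f α y) = 0 := by
      have := hsum fun _ => 1
      simp only [mul_one] at this
      rw [this, hne, Finset.sum_empty]
    rw [hU, mem_setOf_eq, this] at hy
    exact lt_irrefl _ hy
  -- ### the four set identities on `U`
  have hsets : ∀ y ∈ U,
      (y ∈ S i ↔ 0 ≤ u y ∧ 0 ≤ v y) ∧ (y ∈ S j ↔ u y ≤ 0 ∧ u y ≤ v y) ∧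
      (y ∈ S l ↔ v y ≤ 0 ∧ v y ≤ u y) ∧ (y ∈ F ↔ u y = 0 ∧ v y = 0) := by
    intro y hy
    obtain ⟨A, hAne, hApos, hAsrc, hAsum⟩ := key y hy
    obtain ⟨α₀, hα₀⟩ := hAne
    have huA : u y = ∑ α ∈ A, f α y * Θ α y 0 := hAsum fun α => Θ α y 0
    have hvA : v y = ∑ α ∈ A, f α y * Θ α y 1 := hAsum fun α => Θ α y 1
    have hvuA : v y - u y = ∑ α ∈ A, f α y * (Θ α y 1 - Θ α y 0) := by
      rw [huA, hvA, ← Finset.sum_sub_distrib]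
      exact Finset.sum_congr rfl fun α _ => by ring
    -- nonnegative combinations stay in the cones
    have hnn : ∀ t : F → ℝ, (∀ α ∈ A, 0 ≤ t α) → 0 ≤ ∑ α ∈ A, f α y * t α := fun t ht =>
      Finset.sum_nonneg fun α hα => mul_nonneg (hApos α hα).le (ht α hα)
    have hnp : ∀ t : F → ℝ, (∀ α ∈ A, t α ≤ 0) → ∑ α ∈ A, f α y * t α ≤ 0 := fun t ht =>
      Finset.sum_nonpos fun α hα => mul_nonpos_of_nonneg_of_nonpos (hApos α hα).le (ht α hα)
    -- where `y` lives, chart by chart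
    obtain ⟨m, hm⟩ := h.exists_mem y
    have hcases : ∀ i j l m : Fin 3, j = i ∨ l = i ∨ l = j ∨ m = i ∨ m = j ∨ m = l := by decide
    -- the coordinates of `y` in the active charts, according to its sector
    have ci : y ∈ S i → ∀ α ∈ A, 0 ≤ Θ α y 0 ∧ 0 ≤ Θ α y 1 := fun hyi α hα =>
      (hSi α y (hAsrc α hα)).1 hyi
    have cj : y ∈ S j → ∀ α ∈ A, Θ α y 0 ≤ 0 ∧ Θ α y 0 ≤ Θ α y 1 := fun hyj α hα =>
      (hSj α y (hAsrc α hα)).1 hyj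
    have cl : y ∈ S l → ∀ α ∈ A, Θ α y 1 ≤ 0 ∧ Θ α y 1 ≤ Θ α y 0 := fun hyl α hα =>
      (hSl α y (hAsrc α hα)).1 hyl
    refine ⟨⟨fun hyi => ?_, fun huv => ?_⟩, ⟨fun hyj => ?_, fun huv => ?_⟩,
      ⟨fun hyl => ?_, fun huv => ?_⟩, ⟨fun hyF => ?_, fun huv => ?_⟩⟩
    · -- `S i ⇒ Q`
      rw [huA, hvA]
      exact ⟨hnn _ fun α hα => (ci hyi α hα).1, hnn _ fun α hα => (ci hyi α hα).2⟩
    · -- `Q ⇒ S i`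
      rcases hcases i j l m with h' | h' | h' | rfl | rfl | rfl
      · exact absurd h' hji
      · exact absurd h' hli
      · exact absurd h' hlj
      · exact hm
      · -- `y ∈ S j`: all active `u_α` vanish
        have hz : ∀ α ∈ A, Θ α y 0 = 0 :=
          eq_zero_of_sum_mul_nonneg hApos (fun α hα => (cj hm α hα).1) (huA ▸ huv.1)
        exact (hSi α₀ y (hAsrc α₀ hα₀)).2 ⟨le_of_eq (hz α₀ hα₀).symm,
          (hz α₀ hα₀) ▸ (cj hm α₀ hα₀).2⟩
      · -- `y ∈ S l`: all active `v_α` vanish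
        have hz : ∀ α ∈ A, Θ α y 1 = 0 :=
          eq_zero_of_sum_mul_nonneg hApos (fun α hα => (cl hm α hα).1) (hvA ▸ huv.2)
        exact (hSi α₀ y (hAsrc α₀ hα₀)).2 ⟨(hz α₀ hα₀) ▸ (cl hm α₀ hα₀).2,
          le_of_eq (hz α₀ hα₀).symm⟩
    · -- `S j ⇒ W₁`
      refine ⟨by rw [huA]; exact hnp _ fun α hα => (cj hyj α hα).1, ?_⟩
      rw [← sub_nonneg, hvuA]
      exact hnn _ fun α hα => sub_nonneg.mpr (cj hyj α hα).2
    · -- `W₁ ⇒ S j`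
      rcases hcases i j l m with h' | h' | h' | rfl | rfl | rfl
      · exact absurd h' hji
      · exact absurd h' hli
      · exact absurd h' hlj
      · -- `y ∈ S i`
        have hz : ∀ α ∈ A, Θ α y 0 = 0 :=
          eq_zero_of_sum_mul_nonpos hApos (fun α hα => (ci hm α hα).1) (huA ▸ huv.1)
        exact (hSj α₀ y (hAsrc α₀ hα₀)).2 ⟨le_of_eq (hz α₀ hα₀),
          (hz α₀ hα₀).symm ▸ (ci hm α₀ hα₀).2⟩
      · exact hm
      · -- `y ∈ S l`: `u_α = v_α ≤ 0`
        have hz : ∀ α ∈ A, Θ α y 1 - Θ α y 0 = 0 := by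
          refine eq_zero_of_sum_mul_nonneg hApos (fun α hα => sub_nonpos.mpr (cl hm α hα).2) ?_
          rw [← hvuA]; exact sub_nonneg.mpr huv.2
        have he : Θ α₀ y 1 = Θ α₀ y 0 := sub_eq_zero.mp (hz α₀ hα₀)
        exact (hSj α₀ y (hAsrc α₀ hα₀)).2 ⟨he ▸ (cl hm α₀ hα₀).1, le_of_eq he.symm⟩
    · -- `S l ⇒ W₂`
      refine ⟨by rw [hvA]; exact hnp _ fun α hα => (cl hyl α hα).1, ?_⟩
      rw [← sub_nonpos, hvuA]
      exact hnp _ fun α hα => sub_nonpos.mpr (cl hyl α hα).2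
    · -- `W₂ ⇒ S l`
      rcases hcases i j l m with h' | h' | h' | rfl | rfl | rfl
      · exact absurd h' hji
      · exact absurd h' hli
      · exact absurd h' hlj
      · -- `y ∈ S i`
        have hz : ∀ α ∈ A, Θ α y 1 = 0 :=
          eq_zero_of_sum_mul_nonpos hApos (fun α hα => (ci hm α hα).2) (hvA ▸ huv.1)
        exact (hSl α₀ y (hAsrc α₀ hα₀)).2 ⟨le_of_eq (hz α₀ hα₀),
          (hz α₀ hα₀).symm ▸ (ci hm α₀ hα₀).1⟩
      · -- `y ∈ S j`: `u_α = v_α ≤ 0`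
        have hz : ∀ α ∈ A, Θ α y 1 - Θ α y 0 = 0 := by
          refine eq_zero_of_sum_mul_nonpos hApos (fun α hα => sub_nonneg.mpr (cj hm α hα).2) ?_
          rw [← hvuA]; exact sub_nonpos.mpr huv.2
        have he : Θ α₀ y 1 = Θ α₀ y 0 := sub_eq_zero.mp (hz α₀ hα₀)
        exact (hSl α₀ y (hAsrc α₀ hα₀)).2 ⟨he.symm ▸ (cj hm α₀ hα₀).1, le_of_eq he⟩
      · exact hm
    · -- `F ⇒ 0`
      have hz : ∀ α ∈ A, Θ α y 0 = 0 ∧ Θ α y 1 = 0 := fun α hα =>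
        (hFx α y (hAsrc α hα)).1 hyF
      rw [huA, hvA]
      exact ⟨Finset.sum_eq_zero fun α hα => by rw [(hz α hα).1, mul_zero],
        Finset.sum_eq_zero fun α hα => by rw [(hz α hα).2, mul_zero]⟩
    · -- `0 ⇒ F`
      rcases hcases i j l m with h' | h' | h' | rfl | rfl | rfl
      · exact absurd h' hji
      · exact absurd h' hli
      · exact absurd h' hlj
      · have hz0 : ∀ α ∈ A, Θ α y 0 = 0 :=
          eq_zero_of_sum_mul_nonpos hApos (fun α hα => (ci hm α hα).1) (le_of_eq (huA ▸ huv.1))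
        have hz1 : ∀ α ∈ A, Θ α y 1 = 0 :=
          eq_zero_of_sum_mul_nonpos hApos (fun α hα => (ci hm α hα).2) (le_of_eq (hvA ▸ huv.2))
        exact (hFx α₀ y (hAsrc α₀ hα₀)).2 ⟨hz0 α₀ hα₀, hz1 α₀ hα₀⟩
      · have hz0 : ∀ α ∈ A, Θ α y 0 = 0 :=
          eq_zero_of_sum_mul_nonneg hApos (fun α hα => (cj hm α hα).1) (ge_of_eq (huA ▸ huv.1))
        have hz1 : ∀ α ∈ A, Θ α y 1 = 0 := by
          refine eq_zero_of_sum_mul_nonpos hApos (fun α hα => ?_) (le_of_eq (hvA ▸ huv.2))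
          have := (cj hm α hα).2; rw [hz0 α hα] at this; exact this
        exact (hFx α₀ y (hAsrc α₀ hα₀)).2 ⟨hz0 α₀ hα₀, hz1 α₀ hα₀⟩
      · have hz1 : ∀ α ∈ A, Θ α y 1 = 0 :=
          eq_zero_of_sum_mul_nonneg hApos (fun α hα => (cl hm α hα).1) (ge_of_eq (hvA ▸ huv.2))
        have hz0 : ∀ α ∈ A, Θ α y 0 = 0 := by
          refine eq_zero_of_sum_mul_nonpos hApos (fun α hα => ?_) (le_of_eq (huA ▸ huv.1))
          have := (cl hm α hα).2; rw [hz1 α hα] at this; exact this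
        exact (hFx α₀ y (hAsrc α₀ hα₀)).2 ⟨hz0 α₀ hα₀, hz1 α₀ hα₀⟩
  refine ⟨u, v, U, l, hli, hlj, hUopen, hFU, husmooth, hvsmooth, fun y hy => (hsets y hy).1,
    fun y hy => (hsets y hy).2.1, fun y hy => (hsets y hy).2.2.1, fun y hy => (hsets y hy).2.2.2,
    fun x hx => ?_⟩
  -- ### nondegeneracy along `F`
  set β : F := ⟨x, hx⟩ with hβ
  have hxβ : x ∈ (Θ β).source := hΘsrc β
  have hΘβx : Θ β x = 0 := (hΘ β).2.2.1
  -- local finiteness near `x`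
  obtain ⟨N, hN, hNfin⟩ := f.locallyFinite x
  set B : Finset F := hNfin.toFinset with hB
  have hBsum : ∀ y ∈ N, ∀ t : F → X → ℝ,
      (∑ᶠ α, f α y * t α y) = ∑ α ∈ B, f α y * t α y := by
    intro y hy t
    apply finsum_eq_sum_of_support_subset
    intro α hα
    rw [Function.mem_support] at hα
    rw [Finset.mem_coe, hB, Set.Finite.mem_toFinset]
    exact ⟨y, Function.mem_support.2 fun h0 => hα (by rw [h0, zero_mul]), hy⟩
  -- the transitions `T_α = Θ_α ∘ Θ_β⁻¹` and their first-order factor `a_α`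
  set e0 : EuclideanSpace ℝ (Fin 4) := EuclideanSpace.single 0 1 with he0
  set e1 : EuclideanSpace ℝ (Fin 4) := EuclideanSpace.single 1 1 with he1
  set e2 : EuclideanSpace ℝ (Fin 4) := EuclideanSpace.single 2 1 with he2
  set e3 : EuclideanSpace ℝ (Fin 4) := EuclideanSpace.single 3 1 with he3
  set P : Fin 4 → (EuclideanSpace ℝ (Fin 4) →L[ℝ] ℝ) := fun c => EuclideanSpace.proj c with hP
  have hPapply : ∀ c (w : EuclideanSpace ℝ (Fin 4)), P c w = w c := fun c w => rfl
  have hex : ∀ α : F, ∃ a : ℝ, 0 < a ∧ (x ∈ (Θ α).source →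
      HasFDerivAt (fun q => Θ α ((Θ β).symm q) 0) (a • P 0) 0 ∧
      HasFDerivAt (fun q => Θ α ((Θ β).symm q) 1) (a • P 1) 0) := by
    intro α
    by_cases hxα : x ∈ (Θ α).source
    · -- the transition is smooth with injective derivative
      set T : EuclideanSpace ℝ (Fin 4) → EuclideanSpace ℝ (Fin 4) :=
        fun q => Θ α ((Θ β).symm q) with hT
      have hTs : ContDiffAt ℝ ∞ T 0 := by
        have := contDiffAt_transition (A := ContinuousLinearEquiv.refl ℝ _)
          (A' := ContinuousLinearEquiv.refl ℝ _) (hΘmem α) (hΘmem β) hxα hxβ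
        simpa [hT, hΘβx] using this
      have hTd : HasFDerivAt T (fderiv ℝ T 0) 0 := (hTs.differentiableAt (by simp)).hasFDerivAt
      have hTinj : Injective (fderiv ℝ T 0) := by
        have := injective_fderiv_transition (A := ContinuousLinearEquiv.refl ℝ _)
          (A' := ContinuousLinearEquiv.refl ℝ _) (hΘmem α) (hΘmem β) hxα hxβ
        simpa [hT, hΘβx] using this
      -- the cone hypotheses, read off the chart clauses
      have hev : ∀ᶠ z in 𝓝 (0 : EuclideanSpace ℝ (Fin 4)),
          (Θ β).symm z ∈ (Θ α).source ∩ (Θ β).source ∧ Θ β ((Θ β).symm z) = z := by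
        have := eventually_transition (A' := ContinuousLinearEquiv.refl ℝ _) (ψ' := Θ β) hxβ
          (((Θ α).open_source.inter (Θ β).open_source).mem_nhds ⟨hxα, hxβ⟩)
        simpa [hΘβx] using this
      have hQ : ∀ᶠ z in 𝓝 (0 : EuclideanSpace ℝ (Fin 4)),
          (0 ≤ z 0 ∧ 0 ≤ z 1) → (0 ≤ T z 0 ∧ 0 ≤ T z 1) := by
        filter_upwards [hev] with z hz hz'
        obtain ⟨⟨hzα, hzβ⟩, hzz⟩ := hz
        have hyi : (Θ β).symm z ∈ S i := (hSi β _ hzβ).2 (by rw [hzz]; exact hz')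
        exact (hSi α _ hzα).1 hyi
      have hJ : ∀ᶠ z in 𝓝 (0 : EuclideanSpace ℝ (Fin 4)),
          (z 0 ≤ 0 ∧ z 0 ≤ z 1) → (T z 0 ≤ 0 ∧ T z 0 ≤ T z 1) := by
        filter_upwards [hev] with z hz hz'
        obtain ⟨⟨hzα, hzβ⟩, hzz⟩ := hz
        have hyj : (Θ β).symm z ∈ S j := (hSj β _ hzβ).2 (by rw [hzz]; exact hz')
        exact (hSj α _ hzα).1 hyj
      have hK : ∀ᶠ z in 𝓝 (0 : EuclideanSpace ℝ (Fin 4)),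
          (z 1 ≤ 0 ∧ z 1 ≤ z 0) → (T z 1 ≤ 0 ∧ T z 1 ≤ T z 0) := by
        filter_upwards [hev] with z hz hz'
        obtain ⟨⟨hzα, hzβ⟩, hzz⟩ := hz
        have hyl : (Θ β).symm z ∈ S l := (hSl β _ hzβ).2 (by rw [hzz]; exact hz')
        exact (hSl α _ hzα).1 hyl
      obtain ⟨-, a, ha, hformula⟩ := firstOrder_of_jointTransition hTd hTinj hQ hJ hK
      refine ⟨a, ha, fun _ => ⟨?_, ?_⟩⟩
      · have h1 : HasFDerivAt (fun q => T q 0) ((P 0).comp (fderiv ℝ T 0)) 0 :=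
          ((P 0).hasFDerivAt.comp 0 hTd).congr_of_eventuallyEq (Eventually.of_forall fun q => rfl)
        have h2 : (P 0).comp (fderiv ℝ T 0) = a • P 0 := by
          ext w
          simp only [ContinuousLinearMap.comp_apply, hPapply, FunLike.coe_smul,
            Pi.smul_apply, smul_eq_mul]
          exact (hformula w).1
        rw [← h2]; exact h1
      · have h1 : HasFDerivAt (fun q => T q 1) ((P 1).comp (fderiv ℝ T 0)) 0 :=
          ((P 1).hasFDerivAt.comp 0 hTd).congr_of_eventuallyEq (Eventually.of_forall fun q => rfl)
        have h2 : (P 1).comp (fderiv ℝ T 0) = a • P 1 := by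
          ext w
          simp only [ContinuousLinearMap.comp_apply, hPapply, FunLike.coe_smul,
            Pi.smul_apply, smul_eq_mul]
          exact (hformula w).2
        rw [← h2]; exact h1
    · exact ⟨1, one_pos, fun h' => absurd h' hxα⟩
  choose a ha hder using hex
  -- the inverse chart is smooth on its (open) target, a neighbourhood of `0`
  have htgt0 : (0 : EuclideanSpace ℝ (Fin 4)) ∈ (Θ β).target := by
    rw [← hΘβx]; exact (Θ β).map_source hxβ
  have htgt : (Θ β).target ∈ 𝓝 (0 : EuclideanSpace ℝ (Fin 4)) :=
    (Θ β).open_target.mem_nhds htgt0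
  have hΘβsymmOn : ContMDiffOn 𝓘(ℝ, EuclideanSpace ℝ (Fin 4)) (𝓡 4) ∞ (Θ β).symm (Θ β).target :=
    contMDiffOn_symm_of_mem_maximalAtlas (hΘmem β)
  have hΘβsymm : ContMDiffAt 𝓘(ℝ, EuclideanSpace ℝ (Fin 4)) (𝓡 4) ∞ (Θ β).symm 0 :=
    hΘβsymmOn.contMDiffAt htgt
  -- the weights read in the chart
  have hfβ : ∀ α : F, ContDiffAt ℝ ∞ (fun q => f α ((Θ β).symm q)) 0 := fun α =>
    contMDiffAt_iff_contDiffAt.mp (((f α).contMDiff.contMDiffAt).comp 0 hΘβsymm)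
  -- the glued coordinates read in the chart
  set uc : EuclideanSpace ℝ (Fin 4) → ℝ := fun q => u ((Θ β).symm q) with huc
  set vc : EuclideanSpace ℝ (Fin 4) → ℝ := fun q => v ((Θ β).symm q) with hvc
  have hsymm0 : (Θ β).symm 0 = x := by rw [← hΘβx]; exact (Θ β).left_inv hxβ
  have hNev : ∀ᶠ q in 𝓝 (0 : EuclideanSpace ℝ (Fin 4)), (Θ β).symm q ∈ N := by
    have hc : ContinuousAt (Θ β).symm 0 := (Θ β).continuousAt_symm htgt0
    rw [← hsymm0] at hN
    exact hc.preimage_mem_nhds hN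
  set Λ : ℝ := ∑ α ∈ B, f α x * a α with hΛ
  have hΛpos : 0 < Λ := by
    have hterm : ∀ α ∈ B, 0 ≤ f α x * a α := fun α _ => mul_nonneg (f.nonneg α x) (ha α).le
    obtain ⟨α₁, hα₁⟩ := f.exists_pos_of_mem (x := x) hx
    have hα₁B : α₁ ∈ B := by
      rw [hB, Set.Finite.mem_toFinset]
      exact ⟨x, Function.mem_support.2 hα₁.ne', mem_of_mem_nhds hN⟩
    have hlt : 0 < f α₁ x * a α₁ := mul_pos hα₁ (ha α₁)
    calc (0:ℝ) < f α₁ x * a α₁ := hlt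
      _ ≤ Λ := Finset.single_le_sum hterm hα₁B
  -- derivative of each term of the sum
  have hterm : ∀ (α : F) (c : Fin 4), (c = 0 ∨ c = 1) →
      HasFDerivAt (fun q => f α ((Θ β).symm q) * Θ α ((Θ β).symm q) c)
        ((f α x * a α) • P c) 0 := by
    intro α c hc
    by_cases hxα : x ∈ (Θ α).source
    · obtain ⟨hd0, hd1⟩ := hder α hxα
      have hdc : HasFDerivAt (fun q => Θ α ((Θ β).symm q) c) (a α • P c) 0 := by
        rcases hc with rfl | rfl
        exacts [hd0, hd1]
      have hfd : HasFDerivAt (fun q => f α ((Θ β).symm q))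
          (fderiv ℝ (fun q => f α ((Θ β).symm q)) 0) 0 :=
        ((hfβ α).differentiableAt (by simp)).hasFDerivAt
      have hval : Θ α ((Θ β).symm 0) c = 0 := by
        rw [hsymm0]
        obtain ⟨h0, h1⟩ := (hFx α x hxα).1 hx
        rcases hc with rfl | rfl
        exacts [h0, h1]
      have hm := hfd.mul hdc
      rw [hval, zero_smul, add_zero, hsymm0, smul_smul] at hm
      exact hm
    · -- `x ∉ source`: the weight vanishes near `x`
      have hxα' : x ∉ tsupport (f α) := fun h' => hxα (hf α h')
      have hzero : (f α : X → ℝ) =ᶠ[𝓝 x] 0 := notMem_tsupport_iff_eventuallyEq.mp hxα'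
      have hzero' : (fun q => f α ((Θ β).symm q) * Θ α ((Θ β).symm q) c) =ᶠ[𝓝 0]
          fun _ => 0 := by
        have hc' : ContinuousAt (Θ β).symm 0 := (Θ β).continuousAt_symm htgt0
        have : ∀ᶠ q in 𝓝 (0 : EuclideanSpace ℝ (Fin 4)), f α ((Θ β).symm q) = 0 := by
          rw [← hsymm0] at hzero
          exact hc'.eventually hzero
        filter_upwards [this] with q hq
        rw [hq, zero_mul]
      have hfx0 : f α x = 0 := by
        have := hzero.self_of_nhds; simpa using this
      rw [hfx0, zero_mul, zero_smul]
      exact (hasFDerivAt_const (0:ℝ) 0).congr_of_eventuallyEq hzero'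
  have hucd : HasFDerivAt uc (Λ • P 0) 0 := by
    have hsum : HasFDerivAt (fun q => ∑ α ∈ B, f α ((Θ β).symm q) * Θ α ((Θ β).symm q) 0)
        (∑ α ∈ B, (f α x * a α) • P 0) 0 :=
      HasFDerivAt.fun_sum fun α _ => hterm α 0 (Or.inl rfl)
    rw [← Finset.sum_smul] at hsum
    refine hsum.congr_of_eventuallyEq ?_
    filter_upwards [hNev] with q hq
    exact hBsum _ hq fun α y => Θ α y 0
  have hvcd : HasFDerivAt vc (Λ • P 1) 0 := by
    have hsum : HasFDerivAt (fun q => ∑ α ∈ B, f α ((Θ β).symm q) * Θ α ((Θ β).symm q) 1)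
        (∑ α ∈ B, (f α x * a α) • P 1) 0 :=
      HasFDerivAt.fun_sum fun α _ => hterm α 1 (Or.inr rfl)
    rw [← Finset.sum_smul] at hsum
    refine hsum.congr_of_eventuallyEq ?_
    filter_upwards [hNev] with q hq
    exact hBsum _ hq fun α y => Θ α y 1
  -- smoothness of the glued coordinates read in the chart
  have hucs : ContDiffAt ℝ ∞ uc 0 :=
    contMDiffAt_iff_contDiffAt.mp (husmooth.contMDiffAt.comp 0 hΘβsymm)
  have hvcs : ContDiffAt ℝ ∞ vc 0 :=
    contMDiffAt_iff_contDiffAt.mp (hvsmooth.contMDiffAt.comp 0 hΘβsymm)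
  -- the map `G = (u, v, q₂, q₃)` in the chart and its derivative
  set G : EuclideanSpace ℝ (Fin 4) → EuclideanSpace ℝ (Fin 4) := fun q =>
    (uc q) • e0 + (vc q) • e1 + (q 2) • e2 + (q 3) • e3 with hG
  have hc2 : ContDiff ℝ ∞ fun q : EuclideanSpace ℝ (Fin 4) => q 2 :=
    contDiff_piLp_apply (p := 2) (i := (2 : Fin 4))
  have hc3 : ContDiff ℝ ∞ fun q : EuclideanSpace ℝ (Fin 4) => q 3 :=
    contDiff_piLp_apply (p := 2) (i := (3 : Fin 4))
  have hGs : ContDiffAt ℝ ∞ G 0 :=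
    (((hucs.smul contDiffAt_const).add (hvcs.smul contDiffAt_const)).add
      (hc2.contDiffAt.smul contDiffAt_const)).add (hc3.contDiffAt.smul contDiffAt_const)
  set D : EuclideanSpace ℝ (Fin 4) →L[ℝ] EuclideanSpace ℝ (Fin 4) :=
    (Λ • P 0).smulRight e0 + (Λ • P 1).smulRight e1 + (P 2).smulRight e2 + (P 3).smulRight e3
    with hD
  have hproj : ∀ c : Fin 4, HasFDerivAt (fun q : EuclideanSpace ℝ (Fin 4) => q c) (P c) 0 :=
    fun c => ((P c).hasFDerivAt).congr_of_eventuallyEq (Eventually.of_forall fun q => rfl)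
  have hGd : HasFDerivAt G D 0 :=
    (((hucd.smul_const e0).add (hvcd.smul_const e1)).add ((hproj 2).smul_const e2)).add
      ((hproj 3).smul_const e3)
  have hDapply : ∀ w : EuclideanSpace ℝ (Fin 4),
      D w = (Λ * w 0) • e0 + (Λ * w 1) • e1 + (w 2) • e2 + (w 3) • e3 := by
    intro w; simp only [hD]; rfl
  have hD0 : ∀ w, D w 0 = Λ * w 0 := fun w => by rw [hDapply]; simp [he0, he1, he2, he3]
  have hD1 : ∀ w, D w 1 = Λ * w 1 := fun w => by rw [hDapply]; simp [he0, he1, he2, he3]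
  have hD2 : ∀ w, D w 2 = w 2 := fun w => by rw [hDapply]; simp [he0, he1, he2, he3]
  have hD3 : ∀ w, D w 3 = w 3 := fun w => by rw [hDapply]; simp [he0, he1, he2, he3]
  have hDinj : Injective D := by
    intro w w' hww
    have hk0 : w 0 = w' 0 := by
      have := congrArg (fun q : EuclideanSpace ℝ (Fin 4) => q 0) hww
      simp only [hD0] at this
      exact mul_left_cancel₀ hΛpos.ne' this
    have hk1 : w 1 = w' 1 := by
      have := congrArg (fun q : EuclideanSpace ℝ (Fin 4) => q 1) hww
      simp only [hD1] at this
      exact mul_left_cancel₀ hΛpos.ne' this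
    have hk2 : w 2 = w' 2 := by
      have := congrArg (fun q : EuclideanSpace ℝ (Fin 4) => q 2) hww
      simp only [hD2] at this; exact this
    have hk3 : w 3 = w' 3 := by
      have := congrArg (fun q : EuclideanSpace ℝ (Fin 4) => q 3) hww
      simp only [hD3] at this; exact this
    ext c; fin_cases c; exacts [hk0, hk1, hk2, hk3]
  set E : EuclideanSpace ℝ (Fin 4) ≃L[ℝ] EuclideanSpace ℝ (Fin 4) :=
    LinearEquiv.toContinuousLinearEquiv (LinearEquiv.ofInjectiveEndo D.toLinearMap hDinj) with hE
  have hEcoe : (E : EuclideanSpace ℝ (Fin 4) →L[ℝ] EuclideanSpace ℝ (Fin 4)) = D := by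
    ext w c; rfl
  have hGdE : HasFDerivAt G (E : EuclideanSpace ℝ (Fin 4) →L[ℝ] EuclideanSpace ℝ (Fin 4)) 0 := by
    rw [hEcoe]; exact hGd
  -- ### the inverse function theorem and the chart `Ξ = G ∘ Θ_β`
  -- `G` is smooth on a neighbourhood of `0` (it is so at `0`; shrink to where the derivative
  -- is invertible)
  set V : Set (EuclideanSpace ℝ (Fin 4)) := (Θ β).target with hVdef
  have hV0 : (0 : EuclideanSpace ℝ (Fin 4)) ∈ V := htgt0
  have hVopen : IsOpen V := (Θ β).open_target
  have hVs : ContDiffOn ℝ ∞ G V := by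
    have hu' : ContDiffOn ℝ ∞ uc V :=
      contMDiffOn_iff_contDiffOn.mp (husmooth.comp_contMDiffOn hΘβsymmOn)
    have hv' : ContDiffOn ℝ ∞ vc V :=
      contMDiffOn_iff_contDiffOn.mp (hvsmooth.comp_contMDiffOn hΘβsymmOn)
    exact (((hu'.smul contDiffOn_const).add (hv'.smul contDiffOn_const)).add
      (hc2.contDiffOn.smul contDiffOn_const)).add (hc3.contDiffOn.smul contDiffOn_const)
  set Φ₀ := hGs.toOpenPartialHomeomorph G hGdE (by simp) with hΦ₀
  have hΦ₀src : (0 : EuclideanSpace ℝ (Fin 4)) ∈ Φ₀.source :=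
    hGs.mem_toOpenPartialHomeomorph_source hGdE (by simp)
  have hΦ₀coe : (Φ₀ : EuclideanSpace ℝ (Fin 4) → EuclideanSpace ℝ (Fin 4)) = G := rfl
  set U₁ : Set (EuclideanSpace ℝ (Fin 4)) := {q | q ∈ V ∧ fderiv ℝ G q ∈ range ((↑) :
    (EuclideanSpace ℝ (Fin 4) ≃L[ℝ] EuclideanSpace ℝ (Fin 4)) →
      EuclideanSpace ℝ (Fin 4) →L[ℝ] EuclideanSpace ℝ (Fin 4))} with hU₁
  have hU₁open : IsOpen U₁ := by
    have hc : ContinuousOn (fun q => fderiv ℝ G q) V := (hVs.continuousOn_fderiv_of_isOpen hVopen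
      (by simp))
    exact hc.isOpen_inter_preimage hVopen ContinuousLinearEquiv.isOpen
  have hU₁0 : (0 : EuclideanSpace ℝ (Fin 4)) ∈ U₁ := ⟨hV0, ⟨E, hGdE.fderiv.symm⟩⟩
  set Φ := Φ₀.restrOpen U₁ hU₁open with hΦ
  have hΦcoe : (Φ : EuclideanSpace ℝ (Fin 4) → EuclideanSpace ℝ (Fin 4)) = G := rfl
  have hΦsrc0 : (0 : EuclideanSpace ℝ (Fin 4)) ∈ Φ.source := by
    rw [hΦ, OpenPartialHomeomorph.restrOpen_source]; exact ⟨hΦ₀src, hU₁0⟩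
  have hΦsrcU : Φ.source ⊆ U₁ := by
    rw [hΦ, OpenPartialHomeomorph.restrOpen_source]; exact inter_subset_right
  have hΦsmooth : ContDiffOn ℝ ∞ Φ Φ.source := by
    rw [hΦcoe]; exact hVs.mono fun q hq => (hΦsrcU hq).1
  have hΦsymm : ContDiffOn ℝ ∞ Φ.symm Φ.target := by
    intro q hq
    have hq' : Φ.symm q ∈ Φ.source := Φ.map_target hq
    obtain ⟨hqV, Eq, hEq⟩ := hΦsrcU hq'
    have hd : HasFDerivAt Φ (Eq : EuclideanSpace ℝ (Fin 4) →L[ℝ] EuclideanSpace ℝ (Fin 4))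
        (Φ.symm q) := by
      rw [hEq, hΦcoe]
      exact ((hVs.contDiffAt (hVopen.mem_nhds hqV)).differentiableAt (by simp)).hasFDerivAt
    exact (Φ.contDiffAt_symm hq hd (by
      rw [hΦcoe]; exact hVs.contDiffAt (hVopen.mem_nhds hqV))).contDiffWithinAt
  have hΦmem : Φ ∈ contDiffGroupoid ∞ (𝓡 4) := contDiffGroupoid_mem_of_contDiffOn_symm hΦsmooth hΦsymm
  set Ξ := (Θ β).trans Φ with hΞ
  refine ⟨Ξ, trans_mem_maximalAtlas (hΘmem β) hΦmem, ?_, fun y hy => ?_⟩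
  · show x ∈ ((Θ β).trans Φ).source
    rw [OpenPartialHomeomorph.trans_source]
    exact ⟨hxβ, by rw [mem_preimage, hΘβx]; exact hΦsrc0⟩
  · have hyβ : y ∈ (Θ β).source := by
      rw [hΞ, OpenPartialHomeomorph.trans_source] at hy; exact hy.1
    have hΞy : Ξ y = G (Θ β y) := rfl
    have hGq : ∀ q, G q 0 = uc q ∧ G q 1 = vc q := fun q => by
      constructor <;> simp [hG, he0, he1, he2, he3]
    rw [hΞy, (hGq _).1, (hGq _).2]
    show u ((Θ β).symm (Θ β y)) = u y ∧ v ((Θ β).symm (Θ β y)) = v y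
    rw [(Θ β).left_inv hyβ]
    exact ⟨rfl, rfl⟩

end NormalCoordinates

end Literature.Topology.FourManifolds
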